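import Summits.HodgeConjecture.HodgeConjecture.Theorems.K2E1ContinuedEisensteinResidueFunctionUThree   -- ★ (K2E1-p03): `continuous_residueValue`, `residueValue_rational_mul` (top pole `z = 2`); brings `quasiSplit`, `quotFun`, `continuous_quotFun`
import Summits.HodgeConjecture.HodgeConjecture.Theorems.R90S8ResGMidAtomU3Defs                      -- ★ p862682 (K2E1-p11, G-DEFS (3β)): `resGMidAtomGen`, `resGMidAtom`, `resGMidBlock`, `mem_resGMidAtom_of_mem_gen`, `resGMidBlock_ne_bot_of_mem`
import HarnessLib

/-!
# R90-TF · S8 «ContSpec-n½» — `R90S8ResGMidResidueClassNeZeroU3`: A GENUINE POLE GIVES A NONZERO `L²` RESIDUE CLASS (the representation half of #3's (NV) letter, on Mok's carrier)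

Cell `hodgecm-mathlib`, crux H413 (`stmt-HodgeConjecture-24833`, lane `--supports … --as helper`), route of record `HCCMUnconditional`; R90-TF section S8, deal S8-R61 (R90-CS-plan (g2))
«(NV) REPRESENTATION HALF → K2E2-p12 (g8)»: «a GENUINE middle pole gives a NONZERO vector of the middle atom».  Consumer: the (NV) letter `LHalfNeZero (ξ.bcη⁻¹ * μω) → V ≠ ⊥` of socket
#3 `sock_S8_res_piN_occurs` at `V := resGMidBlock ξ …` (K2E1-p11 (g3)'s G-DEFS; the middle atom = closure-span of the `L²` classes of the residues `Res_{z = 3/2} E(φ, z)` of the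
`φ_ξ`-block at level `(K′, ω)`), together with the analytic half ★ `residue_at_threeHalves_ne_zero_iff_cm_three` (R90-C133-p02) and B1∕B2.  THEOREMS ONLY (no `def`, no `instance`,
no notation, no named-fact hypothesis, no `sorry`; default heartbeats); count-neutral; GENERIC: §1 for any `AdelicGroupData`, §2 for `quasiSplit F E c N` at ANY pole `z₀` (the
middle pole `z₀ = 3/2` of `U(2,1)` is the consumer's instance; the by-name edition at `resGMidAtom` follows K2E1-p11's DEF HEADS).

THE MATHEMATICS ([MoeglinWaldspurger1995, I.4.11, IV.1.11]; [Rogawski1990, §13.9 (ii) p. 229]).  Let `Ẽ(z)` be the continued Eisenstein family of the block, left-`G(F)`-invariant for `z`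
near the pole `z₀`, with residue function `r(g) = lim_{z → z₀} (z − z₀)·Ẽ(z)(g)`.  (1) `r` is left-`G(F)`-invariant (limits are unique), hence — `A_G = ⊥` for unitary groups — invariant
under the full quotient subgroup, so it DESCENDS to the automorphic quotient and `quotFun r` is continuous when `r` is (★ `continuous_quotFun`).  (2) If `r` is square-integrable on the
quotient (THE visible letter `hr2 : MemLp (quotFun r) 2 μ` — square-integrability of residues of Eisenstein series [MW95 I.4.11], not in the tree at the middle pole) and `r(g₀) ≠ 0`
for one `g₀`, then its `L²` class is NONZERO: an `L²` class vanishes iff its representative is a.e. zero, and a continuous function that is a.e. zero for a measure charging every open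
set (automorphic measures do, ★ `IsAutomorphicMeasure`) vanishes identically (Mathlib `Continuous.ae_eq_iff_eq`).  (3) Hence every submodule containing the class — the middle atom,
the middle block — is `≠ ⊥`.  Continuity of `r` is ★ `continuous_residueValue` at the top pole `z₀ = 2`; at a general pole it is the same Cauchy-estimate argument (visible here as
`hrc`, an `_at` generalisation of ★ for a later edition).
* §1 `toLp_quotFun_ne_zero_of_apply_ne_zero` — generic `AdelicGroupData`: continuous, quotient-invariant, square-integrable `φ` with `φ g₀ ≠ 0` has nonzero `L²` class;
  `ne_bot_of_mem_of_ne_zero`.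
* §2 `residueFun_arithmetic_mul` (any pole `z₀`, `quasiSplit F E c N`), `residueFun_quotientSubgroup_mul` (`A_G = ⊥`), `continuous_quotFun_residueFun`,
  **`toLp_residueFun_ne_zero`**, **`ne_bot_of_residueClass_mem`** — THE (NV) REPRESENTATION HALF: a genuine pole (`r g₀ ≠ 0`) gives a nonzero `L²` residue class, so any
  submodule containing it (the middle atom ∕ block of K2E1-p11's G-DEFS) is `≠ ⊥`.
HONEST LABEL: HC_CM is proved only modulo the 7 printed citations (2 remaining named inputs: hLiu418 = `stmt-HodgeConjecture-24832`, h413 = `stmt-HodgeConjecture-24833`) until rung 0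
closes; count-neutral helper; closes no socket; visible letters: `hr2` (square-integrability of the residue) and `hrc` (continuity of the residue function at the given pole).

## References
* [MoeglinWaldspurger1995] C. Mœglin, J.-L. Waldspurger, *Spectral Decomposition and Eisenstein Series* (1995), I.4.11 (square-integrability of residues), IV.1.11.
* [Rogawski1990] J. D. Rogawski, *Automorphic Representations of Unitary Groups in Three Variables* (1990), §13.9 (ii) p. 229, Thm. 13.3.6 (b) p. 202.
-/

set_option autoImplicit false
-- the mandated namespace repeats the single-problem summit's segment (`HodgeConjecture.HodgeConjecture`)
set_option linter.dupNamespace false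

noncomputable section

open MeasureTheory Measure NumberField Set Filter Topology Metric
open scoped ENNReal NNReal
open Literature.NumberTheory.Automorphic Literature.NumberTheory.Automorphic.UnitaryGroup AdelicGroupData

namespace Summit.HodgeConjecture.HodgeConjecture.R90.S8

universe u

/-! ## §1 Generic: a continuous, invariant, square-integrable function with a nonzero value has a nonzero `L²` class -/

section Generic

variable {K : Type} [Field K] [NumberField K] {𝒢 : AdelicGroupData.{u} K}
  (μ : Measure 𝒢.automorphicQuotient) [𝒢.IsAutomorphicMeasure μ]

/-- **NONZERO VALUE ⟹ NONZERO `L²` CLASS**: for `φ : G(𝔸) → ℂ` continuous, left-invariant under `A_G·G(K)` and with `quotFun φ ∈ L²(μ)`, `φ g₀ ≠ 0` forces `[quotFun φ] ≠ 0` in `L²`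
— an `L²` class is zero iff its representative is a.e. zero, and a continuous function a.e. zero for the open-positive automorphic measure `μ` is zero (Mathlib `Continuous.ae_eq_iff_eq`;
★ `continuous_quotFun`; `quotFun φ [g₀⁻¹] = φ g₀`). [cite: MoeglinWaldspurger1995, I.4.11] -/
theorem toLp_quotFun_ne_zero_of_apply_ne_zero {φ : 𝒢.Adelic → ℂ} (hφi : ∀ γ ∈ 𝒢.quotientSubgroup, ∀ g, φ (γ * g) = φ g) (hφc : Continuous φ)
    (h2 : MemLp (𝒢.quotFun φ) 2 μ) {g₀ : 𝒢.Adelic} (h0 : φ g₀ ≠ 0) : h2.toLp (𝒢.quotFun φ) ≠ 0 := by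
  intro h
  have hae : 𝒢.quotFun φ =ᵐ[μ] (fun _ => (0 : ℂ)) := by
    have h1 := h2.coeFn_toLp
    rw [h] at h1
    filter_upwards [h1, Lp.coeFn_zero ℂ 2 μ] with x hx hx0
    rw [← hx]
    exact hx0
  have heq : 𝒢.quotFun φ = fun _ => (0 : ℂ) := (Continuous.ae_eq_iff_eq μ (AdelicGroupData.continuous_quotFun hφi hφc) continuous_const).1 hae
  have hval : 𝒢.quotFun φ (𝒢.toAutomorphicQuotient g₀⁻¹) = φ g₀ := by
    rw [AdelicGroupData.quotFun_toAutomorphicQuotient hφi, inv_inv]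
  exact h0 (by rw [← hval, heq])

omit [𝒢.IsAutomorphicMeasure μ] in
/-- A submodule containing a nonzero vector is `≠ ⊥`. [folklore] -/
theorem ne_bot_of_mem_of_ne_zero {V : Submodule ℂ (𝒢.L2 μ)} {v : 𝒢.L2 μ} (hv : v ∈ V) (hv0 : v ≠ 0) : V ≠ ⊥ := fun h =>
  hv0 ((Submodule.mem_bot ℂ).1 (h ▸ hv))

end Generic

/-! ## §2 The residue function of a continued family at a pole `z₀` on `quasiSplit F E c N`: invariance, descent, nonzero class -/

section Residue

variable {F E : Type} [Field F] [NumberField F] [Field E] [NumberField E] [Algebra F E] {c : E ≃ₐ[F] E} {N : ℕ}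

/-- **THE RESIDUE FUNCTION IS LEFT-`G(F)`-INVARIANT** at any pole `z₀`: if `(z − z₀)·Ẽ(z)(g) → r(g)` along `𝓝[≠] z₀` and `Ẽ(z)` is left-`G(F)`-invariant for `z ∈ D`, `D ∈ 𝓝[≠] z₀`,
then `r(γ·g) = r(g)` (limits along `𝓝[≠] z₀` are unique; the `_at` form of ★ `residueValue_rational_mul`). [cite: MoeglinWaldspurger1995, IV.1.11] -/
theorem residueFun_arithmetic_mul (Ec : ℂ → (quasiSplit F E c N).Adelic → ℂ) {D : Set ℂ} {z₀ : ℂ} (hD : ∀ᶠ z in 𝓝[≠] z₀, z ∈ D)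
    (hEcinv : ∀ z ∈ D, ∀ (γ : (quasiSplit F E c N).arithmeticSubgroup) (x : (quasiSplit F E c N).Adelic), Ec z ((γ : (quasiSplit F E c N).Adelic) * x) = Ec z x)
    {r : (quasiSplit F E c N).Adelic → ℂ} (hr : ∀ g, Tendsto (fun z : ℂ => (z - z₀) * Ec z g) (𝓝[≠] z₀) (𝓝 (r g)))
    (γ : (quasiSplit F E c N).arithmeticSubgroup) (x : (quasiSplit F E c N).Adelic) : r ((γ : (quasiSplit F E c N).Adelic) * x) = r x := by
  have heq : (fun z : ℂ => (z - z₀) * Ec z ((γ : (quasiSplit F E c N).Adelic) * x)) =ᶠ[𝓝[≠] z₀] fun z => (z - z₀) * Ec z x := by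
    filter_upwards [hD] with z hzD
    rw [hEcinv z hzD γ x]
  exact tendsto_nhds_unique ((hr _).congr' heq) (hr x)

/-- … hence invariant under the whole quotient subgroup `A_G·G(F)` (`A_G = ⊥` for the unitary datum `quasiSplit`). [cite: MoeglinWaldspurger1995, IV.1.11] -/
theorem residueFun_quotientSubgroup_mul (Ec : ℂ → (quasiSplit F E c N).Adelic → ℂ) {D : Set ℂ} {z₀ : ℂ} (hD : ∀ᶠ z in 𝓝[≠] z₀, z ∈ D)
    (hEcinv : ∀ z ∈ D, ∀ (γ : (quasiSplit F E c N).arithmeticSubgroup) (x : (quasiSplit F E c N).Adelic), Ec z ((γ : (quasiSplit F E c N).Adelic) * x) = Ec z x)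
    {r : (quasiSplit F E c N).Adelic → ℂ} (hr : ∀ g, Tendsto (fun z : ℂ => (z - z₀) * Ec z g) (𝓝[≠] z₀) (𝓝 (r g))) :
    ∀ γ ∈ (quasiSplit F E c N).quotientSubgroup, ∀ g, r (γ * g) = r g := by
  intro γ hγ g
  rw [AdelicGroupData.quotientSubgroup, show (quasiSplit F E c N).center' = ⊥ from rfl, bot_sup_eq] at hγ
  exact residueFun_arithmetic_mul Ec hD hEcinv hr ⟨γ, hγ⟩ g

/-- The residue function descends to a CONTINUOUS function on the automorphic quotient when it is continuous on `G(𝔸)` (★ `continuous_quotFun`; continuity of `r` itself is ★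
`continuous_residueValue` at the top pole and the same Cauchy estimate at any pole). [cite: MoeglinWaldspurger1995, IV.1.11] -/
theorem continuous_quotFun_residueFun (Ec : ℂ → (quasiSplit F E c N).Adelic → ℂ) {D : Set ℂ} {z₀ : ℂ} (hD : ∀ᶠ z in 𝓝[≠] z₀, z ∈ D)
    (hEcinv : ∀ z ∈ D, ∀ (γ : (quasiSplit F E c N).arithmeticSubgroup) (x : (quasiSplit F E c N).Adelic), Ec z ((γ : (quasiSplit F E c N).Adelic) * x) = Ec z x)
    {r : (quasiSplit F E c N).Adelic → ℂ} (hr : ∀ g, Tendsto (fun z : ℂ => (z - z₀) * Ec z g) (𝓝[≠] z₀) (𝓝 (r g))) (hrc : Continuous r) :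
    Continuous ((quasiSplit F E c N).quotFun r) :=
  AdelicGroupData.continuous_quotFun (residueFun_quotientSubgroup_mul Ec hD hEcinv hr) hrc

variable (μ : Measure (quasiSplit F E c N).automorphicQuotient) [(quasiSplit F E c N).IsAutomorphicMeasure μ]

/-- **(NV), REPRESENTATION HALF — A GENUINE POLE GIVES A NONZERO `L²` RESIDUE CLASS**: for the continued family `Ẽ` of a block (left-`G(F)`-invariant near the pole `z₀`) with residue
function `r` (`(z − z₀)·Ẽ(z)(g) → r(g)`), continuous (`hrc`) and square-integrable on the quotient (`hr2`, [MW95 I.4.11] — THE visible letter), a NONZERO residue value `r g₀ ≠ 0`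
(a genuine pole: the analytic half ★ `residue_at_threeHalves_ne_zero_iff_cm_three` supplies it from `L(½, ξ·bcη⁻¹·μω) ≠ 0` at the middle pole `z₀ = 3/2` of `U(2,1)`) makes the `L²`
class `[r] ≠ 0`. [cite: MoeglinWaldspurger1995, I.4.11, IV.1.11] [cite: Rogawski1990, §13.9 (ii) p. 229] -/
theorem toLp_residueFun_ne_zero (Ec : ℂ → (quasiSplit F E c N).Adelic → ℂ) {D : Set ℂ} {z₀ : ℂ} (hD : ∀ᶠ z in 𝓝[≠] z₀, z ∈ D)
    (hEcinv : ∀ z ∈ D, ∀ (γ : (quasiSplit F E c N).arithmeticSubgroup) (x : (quasiSplit F E c N).Adelic), Ec z ((γ : (quasiSplit F E c N).Adelic) * x) = Ec z x)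
    {r : (quasiSplit F E c N).Adelic → ℂ} (hr : ∀ g, Tendsto (fun z : ℂ => (z - z₀) * Ec z g) (𝓝[≠] z₀) (𝓝 (r g))) (hrc : Continuous r)
    (hr2 : MemLp ((quasiSplit F E c N).quotFun r) 2 μ) {g₀ : (quasiSplit F E c N).Adelic} (hr0 : r g₀ ≠ 0) :
    hr2.toLp ((quasiSplit F E c N).quotFun r) ≠ 0 :=
  toLp_quotFun_ne_zero_of_apply_ne_zero μ (residueFun_quotientSubgroup_mul Ec hD hEcinv hr) hrc hr2 hr0

/-- **… SO EVERY SUBMODULE CONTAINING THE RESIDUE CLASS IS `≠ ⊥`** — the (NV) letter's conclusion `V ≠ ⊥` for the middle atom ∕ middle block `V` of K2E1-p11's G-DEFS (which contain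
the residue classes by definition). [cite: MoeglinWaldspurger1995, I.4.11] [cite: Rogawski1990, Thm. 13.3.6 (b) p. 202] -/
theorem ne_bot_of_residueClass_mem (Ec : ℂ → (quasiSplit F E c N).Adelic → ℂ) {D : Set ℂ} {z₀ : ℂ} (hD : ∀ᶠ z in 𝓝[≠] z₀, z ∈ D)
    (hEcinv : ∀ z ∈ D, ∀ (γ : (quasiSplit F E c N).arithmeticSubgroup) (x : (quasiSplit F E c N).Adelic), Ec z ((γ : (quasiSplit F E c N).Adelic) * x) = Ec z x)
    {r : (quasiSplit F E c N).Adelic → ℂ} (hr : ∀ g, Tendsto (fun z : ℂ => (z - z₀) * Ec z g) (𝓝[≠] z₀) (𝓝 (r g))) (hrc : Continuous r)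
    (hr2 : MemLp ((quasiSplit F E c N).quotFun r) 2 μ) {g₀ : (quasiSplit F E c N).Adelic} (hr0 : r g₀ ≠ 0)
    {V : Submodule ℂ ((quasiSplit F E c N).L2 μ)} (hV : hr2.toLp ((quasiSplit F E c N).quotFun r) ∈ V) : V ≠ ⊥ :=
  ne_bot_of_mem_of_ne_zero μ hV (toLp_residueFun_ne_zero μ Ec hD hEcinv hr hrc hr2 hr0)

/-- **POLE-LETTER FORM** (the currency of the ★ export files: `Fp g` analytic at `z₀`, `Fp g =ᶠ[𝓝[≠] z₀] (z − z₀)·Ẽ(z)(g)`, residue function `g ↦ Fp g z₀`): a nonzero residue value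
gives a nonzero class and a non-`⊥` container. [cite: MoeglinWaldspurger1995, I.4.11, IV.1.11] [cite: Rogawski1990, §13.9 (ii) p. 229] -/
theorem ne_bot_of_poleLetter_residueClass_mem (Ec : ℂ → (quasiSplit F E c N).Adelic → ℂ) {D : Set ℂ} {z₀ : ℂ} (hD : ∀ᶠ z in 𝓝[≠] z₀, z ∈ D)
    (hEcinv : ∀ z ∈ D, ∀ (γ : (quasiSplit F E c N).arithmeticSubgroup) (x : (quasiSplit F E c N).Adelic), Ec z ((γ : (quasiSplit F E c N).Adelic) * x) = Ec z x)
    (Fp : (quasiSplit F E c N).Adelic → ℂ → ℂ) (hF : ∀ g, AnalyticAt ℂ (Fp g) z₀) (hFE : ∀ g, Fp g =ᶠ[𝓝[≠] z₀] fun z => (z - z₀) * Ec z g)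
    (hrc : Continuous fun g => Fp g z₀) (hr2 : MemLp ((quasiSplit F E c N).quotFun fun g => Fp g z₀) 2 μ) {g₀ : (quasiSplit F E c N).Adelic} (hr0 : Fp g₀ z₀ ≠ 0)
    {V : Submodule ℂ ((quasiSplit F E c N).L2 μ)} (hV : hr2.toLp ((quasiSplit F E c N).quotFun fun g => Fp g z₀) ∈ V) :
    hr2.toLp ((quasiSplit F E c N).quotFun fun g => Fp g z₀) ≠ 0 ∧ V ≠ ⊥ := by
  have hr : ∀ g, Tendsto (fun z : ℂ => (z - z₀) * Ec z g) (𝓝[≠] z₀) (𝓝 (Fp g z₀)) := fun g =>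
    (tendsto_nhdsWithin_of_tendsto_nhds (hF g).continuousAt.tendsto).congr' (hFE g)
  exact ⟨toLp_residueFun_ne_zero μ Ec hD hEcinv hr hrc hr2 hr0, ne_bot_of_residueClass_mem μ Ec hD hEcinv hr hrc hr2 hr0 hV⟩

end Residue

/-! ## §3 (ED. 2) Continuity of the residue function at ANY pole — the `hrc` letter discharged from the LAYER-2 letters -/

section ResidueContinuity

variable {F E : Type} [Field F] [NumberField F] [Field E] [NumberField E] [Algebra F E] {c : E ≃ₐ[F] E} {N : ℕ}

/-- **THE POLE-FREE EXTENSION at a general pole `z₀`**: `Φ_g(z) = (z−z₀)Ẽ(z)(g)` (`z ≠ z₀`), `Φ_g(z₀) = Fp g z₀` is holomorphic on `B(z₀,ρ)` (off `z₀` by (E1) on `D ⊇ B(z₀,ρ)∖{z₀}`; at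
`z₀` it agrees with the analytic `Fp g`) — the `_at` form of ★ `differentiableOn_extension`. [cite: MoeglinWaldspurger1995, IV.1.11] -/
theorem differentiableOn_extension_at (Ec : ℂ → (quasiSplit F E c N).Adelic → ℂ) {D : Set ℂ} (hDo : IsOpen D) {z₀ : ℂ} {ρ : ℝ}
    (hρD : ∀ z : ℂ, z ≠ z₀ → dist z z₀ < ρ → z ∈ D) (hEd : ∀ g, DifferentiableOn ℂ (fun z => Ec z g) D)
    (Fp : (quasiSplit F E c N).Adelic → ℂ → ℂ) (hF : ∀ g, AnalyticAt ℂ (Fp g) z₀) (hFE : ∀ g, Fp g =ᶠ[𝓝[≠] z₀] fun z => (z - z₀) * Ec z g)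
    (g : (quasiSplit F E c N).Adelic) :
    DifferentiableOn ℂ (fun z : ℂ => if z = z₀ then Fp g z₀ else (z - z₀) * Ec z g) (ball z₀ ρ) := by
  intro z hz
  by_cases h2 : z = z₀
  · subst h2
    have hev : (fun w : ℂ => if w = z then Fp g z else (w - z) * Ec w g) =ᶠ[𝓝 z] Fp g := by
      have h := eventually_nhdsWithin_iff.1 (hFE g)
      filter_upwards [h] with w hw
      by_cases hw2 : w = z
      · rw [if_pos hw2, hw2]
      · rw [if_neg hw2, hw hw2]
    exact ((hF g).differentiableAt.congr_of_eventuallyEq hev).differentiableWithinAt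
  · have hzD : z ∈ D := hρD z h2 (mem_ball.1 hz)
    have hev : (fun w : ℂ => if w = z₀ then Fp g z₀ else (w - z₀) * Ec w g) =ᶠ[𝓝 z] fun w => (w - z₀) * Ec w g := by
      filter_upwards [isOpen_ne.mem_nhds h2] with w hw
      rw [if_neg hw]
    have hd : DifferentiableAt ℂ (fun w => (w - z₀) * Ec w g) z :=
      ((differentiableAt_id.sub (differentiableAt_const _)).mul ((hEd g).differentiableAt (hDo.mem_nhds hzD)))
    exact (hd.congr_of_eventuallyEq hev).differentiableWithinAt

/-- **THE COMPACT-UNIFORM BOUND NEAR A GENERAL POLE `z₀`**: for every compact `K ⊆ G(𝔸)` there is `M` bounding the extension on the sphere `|z − z₀| = ρ∕2`, `(z−z₀)Ẽ(z)(g)` on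
`0 < |z−z₀| ≤ ρ∕2` and `Fp g z₀`, uniformly in `g ∈ K` (maximum modulus from (E2-bd) on the compact sphere ⊆ `D`) — the `_at` form of ★ `exists_forall_norm_sub_mul_le_near_two`.
[cite: MoeglinWaldspurger1995, IV.1.11] [cite: Conway1978, VI §1] -/
theorem exists_forall_norm_sub_mul_le_near_at (Ec : ℂ → (quasiSplit F E c N).Adelic → ℂ) {D : Set ℂ} (hDo : IsOpen D) {z₀ : ℂ} {ρ : ℝ} (hρ : 0 < ρ)
    (hρD : ∀ z : ℂ, z ≠ z₀ → dist z z₀ < ρ → z ∈ D) (hEd : ∀ g, DifferentiableOn ℂ (fun z => Ec z g) D)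
    (hEbd : ∀ z₁ ∈ D, ∀ K : Set (quasiSplit F E c N).Adelic, IsCompact K → ∃ V ∈ 𝓝 z₁, ∃ M : ℝ, ∀ z ∈ V, ∀ g ∈ K, ‖Ec z g‖ ≤ M)
    (Fp : (quasiSplit F E c N).Adelic → ℂ → ℂ) (hF : ∀ g, AnalyticAt ℂ (Fp g) z₀) (hFE : ∀ g, Fp g =ᶠ[𝓝[≠] z₀] fun z => (z - z₀) * Ec z g)
    {K : Set (quasiSplit F E c N).Adelic} (hK : IsCompact K) :
    ∃ M : ℝ, (∀ g ∈ K, ∀ w ∈ sphere z₀ (ρ / 2), ‖(if w = z₀ then Fp g z₀ else (w - z₀) * Ec w g)‖ ≤ M) ∧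
      (∀ g ∈ K, ∀ z : ℂ, z ≠ z₀ → dist z z₀ ≤ ρ / 2 → ‖(z - z₀) * Ec z g‖ ≤ M) ∧ ∀ g ∈ K, ‖Fp g z₀‖ ≤ M := by
  have hS : IsCompact (sphere z₀ (ρ / 2)) := isCompact_sphere _ _
  have hSD : sphere z₀ (ρ / 2) ⊆ D := fun w hw => by
    have hw' : dist w z₀ = ρ / 2 := hw
    refine hρD w (fun h => ?_) (by rw [hw']; linarith)
    rw [h, dist_self] at hw'
    linarith
  obtain ⟨M₀, hM₀⟩ := Cruxes.H413.K2E1ContinuedEisensteinResidueFunctionUThree.exists_forall_norm_le_of_isCompact_of_locally_bounded Ec hS hSD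
    fun z₁ hz₁ => hEbd z₁ hz₁ K hK
  set M : ℝ := ρ / 2 * max M₀ 0 with hM
  have hsphere : ∀ g ∈ K, ∀ w ∈ sphere z₀ (ρ / 2), ‖(if w = z₀ then Fp g z₀ else (w - z₀) * Ec w g)‖ ≤ M := fun g hg w hw => by
    have hw' : dist w z₀ = ρ / 2 := hw
    have hw2 : w ≠ z₀ := fun h => by rw [h, dist_self] at hw'; linarith
    rw [if_neg hw2, norm_mul, ← dist_eq_norm, hw', hM]
    exact mul_le_mul_of_nonneg_left ((hM₀ w hw g hg).trans (le_max_left _ _)) (by linarith)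
  have hball := Cruxes.H413.K2E1ContinuedEisensteinResidueFunctionUThree.norm_le_of_sphere_bound (half_pos hρ) (half_lt_self hρ)
    (fun g _ => differentiableOn_extension_at Ec hDo hρD hEd Fp hF hFE g) hsphere
  refine ⟨M, hsphere, fun g hg z hz2 hz => ?_, fun g hg => ?_⟩
  · have h := hball g hg z (mem_closedBall.2 hz)
    rwa [if_neg hz2] at h
  · have h := hball g hg z₀ (mem_closedBall_self (by linarith))
    rwa [if_pos rfl] at h

/-- **THE RESIDUE FUNCTION `g ↦ Fp g z₀ = Res_{z=z₀} Ẽ(z)(g)` IS CONTINUOUS ON `G(𝔸)` at ANY pole `z₀`**: on every compact `K` it is the UNIFORM limit (Schwarz) of the continuous functions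
`g ↦ (z−z₀)Ẽ(z)(g)` ((E4)), `z → z₀`; `G(𝔸)` is locally compact — the `_at` form of ★ `continuous_residueValue` (typed there at the top pole `z₀ = 2`, `N = 3`), discharging the `hrc`
letter of §2 from the LAYER-2 letters. [cite: MoeglinWaldspurger1995, IV.1.11] [cite: Conway1978, VI §2] -/
theorem continuous_residueValue_at (Ec : ℂ → (quasiSplit F E c N).Adelic → ℂ) {D : Set ℂ} (hDo : IsOpen D) {z₀ : ℂ} {ρ : ℝ} (hρ : 0 < ρ)
    (hρD : ∀ z : ℂ, z ≠ z₀ → dist z z₀ < ρ → z ∈ D) (hEd : ∀ g, DifferentiableOn ℂ (fun z => Ec z g) D) (hE4 : ∀ z ∈ D, Continuous (Ec z))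
    (hEbd : ∀ z₁ ∈ D, ∀ K : Set (quasiSplit F E c N).Adelic, IsCompact K → ∃ V ∈ 𝓝 z₁, ∃ M : ℝ, ∀ z ∈ V, ∀ g ∈ K, ‖Ec z g‖ ≤ M)
    (Fp : (quasiSplit F E c N).Adelic → ℂ → ℂ) (hF : ∀ g, AnalyticAt ℂ (Fp g) z₀) (hFE : ∀ g, Fp g =ᶠ[𝓝[≠] z₀] fun z => (z - z₀) * Ec z g) :
    Continuous fun g : (quasiSplit F E c N).Adelic => Fp g z₀ := by
  haveI := t2Space_adeleRing_of_numberField E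
  haveI := locallyCompactSpace_adeleRing' E
  haveI : LocallyCompactSpace (quasiSplit F E c N).Adelic := inferInstanceAs (LocallyCompactSpace (adelic F E c N ((StdForm.antidiagonal N).over E)))
  refine continuous_iff_continuousAt.2 fun g₀ => ?_
  obtain ⟨K, hK, hKg₀⟩ := exists_compact_mem_nhds g₀
  obtain ⟨M, hsphere, -, -⟩ := exists_forall_norm_sub_mul_le_near_at Ec hDo hρ hρD hEd hEbd Fp hF hFE hK
  have hunif := Cruxes.H413.K2E1ContinuedEisensteinResidueFunctionUThree.tendstoUniformlyOn_of_sphere_bound (half_pos hρ) (half_lt_self hρ)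
    (fun g _ => differentiableOn_extension_at Ec hDo hρD hEd Fp hF hFE g) hsphere
  -- each approximant `g ↦ (z−z₀)Ẽ(z)(g)` is continuous for `z ∈ D`, and `z ∈ D` frequently along `𝓝[≠] z₀`
  have hfreq : ∃ᶠ z in 𝓝[≠] z₀, ContinuousOn (fun g : (quasiSplit F E c N).Adelic => if z = z₀ then Fp g z₀ else (z - z₀) * Ec z g) K := by
    refine Filter.Eventually.frequently ?_
    have hmem : {z : ℂ | z ≠ z₀} ∩ ball z₀ ρ ∈ 𝓝[≠] z₀ := inter_mem_nhdsWithin _ (ball_mem_nhds _ hρ)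
    filter_upwards [hmem] with z hz
    have hz2 : z ≠ z₀ := hz.1
    have hzD : z ∈ D := hρD z hz2 (mem_ball.1 hz.2)
    simp only [if_neg hz2]
    exact (continuous_const.mul (hE4 z hzD)).continuousOn
  have hcont := hunif.continuousOn hfreq
  exact (hcont.congr fun g _ => (if_pos rfl).symm).continuousAt hKg₀

variable (μ : Measure (quasiSplit F E c N).automorphicQuotient) [(quasiSplit F E c N).IsAutomorphicMeasure μ]

/-- **(NV), REPRESENTATION HALF, FROM THE LAYER-2 LETTERS ALONE (ED. 2)**: with the continuity letter `hrc` of `ne_bot_of_poleLetter_residueClass_mem` DISCHARGED by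
`continuous_residueValue_at` — holomorphy (E1), continuity (E4), local bounds (E2-bd) and `G(F)`-invariance of `Ẽ` on `D ⊇ B(z₀, ρ) ∖ {z₀}`, a pole letter `Fp` at `z₀`, the
square-integrability letter `hr2` and ONE nonzero residue value give a nonzero `L²` residue class, so every submodule containing it is `≠ ⊥`.
[cite: MoeglinWaldspurger1995, I.4.11, IV.1.11] [cite: Rogawski1990, §13.9 (ii) p. 229] -/
theorem ne_bot_of_poleLetter_residueClass_mem_of_letters (Ec : ℂ → (quasiSplit F E c N).Adelic → ℂ) {D : Set ℂ} (hDo : IsOpen D) {z₀ : ℂ} {ρ : ℝ} (hρ : 0 < ρ)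
    (hρD : ∀ z : ℂ, z ≠ z₀ → dist z z₀ < ρ → z ∈ D) (hEd : ∀ g, DifferentiableOn ℂ (fun z => Ec z g) D) (hE4 : ∀ z ∈ D, Continuous (Ec z))
    (hEbd : ∀ z₁ ∈ D, ∀ K : Set (quasiSplit F E c N).Adelic, IsCompact K → ∃ V ∈ 𝓝 z₁, ∃ M : ℝ, ∀ z ∈ V, ∀ g ∈ K, ‖Ec z g‖ ≤ M)
    (hEcinv : ∀ z ∈ D, ∀ (γ : (quasiSplit F E c N).arithmeticSubgroup) (x : (quasiSplit F E c N).Adelic), Ec z ((γ : (quasiSplit F E c N).Adelic) * x) = Ec z x)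
    (Fp : (quasiSplit F E c N).Adelic → ℂ → ℂ) (hF : ∀ g, AnalyticAt ℂ (Fp g) z₀) (hFE : ∀ g, Fp g =ᶠ[𝓝[≠] z₀] fun z => (z - z₀) * Ec z g)
    (hr2 : MemLp ((quasiSplit F E c N).quotFun fun g => Fp g z₀) 2 μ) {g₀ : (quasiSplit F E c N).Adelic} (hr0 : Fp g₀ z₀ ≠ 0)
    {V : Submodule ℂ ((quasiSplit F E c N).L2 μ)} (hV : hr2.toLp ((quasiSplit F E c N).quotFun fun g => Fp g z₀) ∈ V) :
    hr2.toLp ((quasiSplit F E c N).quotFun fun g => Fp g z₀) ≠ 0 ∧ V ≠ ⊥ := by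
  have hD : ∀ᶠ z in 𝓝[≠] z₀, z ∈ D := by
    filter_upwards [inter_mem_nhdsWithin _ (ball_mem_nhds z₀ hρ)] with z hz
    exact hρD z hz.1 (mem_ball.1 hz.2)
  exact ne_bot_of_poleLetter_residueClass_mem μ Ec hD hEcinv Fp hF hFE (continuous_residueValue_at Ec hDo hρ hρD hEd hE4 hEbd Fp hF hFE) hr2 hr0 hV

end ResidueContinuity

/-! ## §4 (ED. 3) BY NAME at K2E1-p11's G-DEFS: a genuine middle pole makes `resGMidAtom` and `resGMidBlock` non-zero -/

section ByName

open Literature.NumberTheory.Rogawski1990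
open Literature.NumberTheory.GaloisRepresentations (HeckeCharacter)
open Summit.HodgeConjecture.HodgeConjecture.Cruxes.H413.K2E1BorelEisensteinU
open Summit.HodgeConjecture.HodgeConjecture.Cruxes.H413.K2E1ChiSectionSpaceU3PairDefs

variable (L : Type) [Field L] [NumberField L] [IsCMField L]
  (μ : Measure (quasiSplit (↥(maximalRealSubfield L)) L (IsCMField.complexConj L) 3).automorphicQuotient) [(quasiSplit (↥(maximalRealSubfield L)) L (IsCMField.complexConj L) 3).IsAutomorphicMeasure μ]

/-- A punctured disc around `3/2` inside the generator's holomorphy domain `{1 < Re} ∖ Sp` (`Sp` finite). [folklore] -/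
theorem exists_puncturedBall_subset_of_finset (Sp : Finset ℂ) :
    ∃ ρ : ℝ, 0 < ρ ∧ ∀ z : ℂ, z ≠ (3 : ℂ) / 2 → dist z ((3 : ℂ) / 2) < ρ → z ∈ ({z : ℂ | 1 < z.re} \ (↑Sp : Set ℂ)) := by
  have hopen : IsOpen ({z : ℂ | 1 < z.re} \ ((↑Sp : Set ℂ) \ {(3 : ℂ) / 2})) :=
    (isOpen_lt continuous_const Complex.continuous_re).sdiff ((Sp.finite_toSet.subset fun x hx => hx.1).isClosed)
  have hmem : (3 : ℂ) / 2 ∈ {z : ℂ | 1 < z.re} \ ((↑Sp : Set ℂ) \ {(3 : ℂ) / 2}) := by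
    refine ⟨?_, fun h => h.2 rfl⟩
    show (1 : ℝ) < ((3 : ℂ) / 2).re
    norm_num
  obtain ⟨ρ, hρ, hball⟩ := Metric.isOpen_iff.1 hopen _ hmem
  refine ⟨ρ, hρ, fun z hz hzd => ?_⟩
  have h := hball (mem_ball.2 hzd)
  exact ⟨h.1, fun hzS => h.2 ⟨hzS, hz⟩⟩

/-- **(NV), REPRESENTATION HALF, BY NAME — A GENUINE MIDDLE POLE MAKES `resGMidAtom ξ μω K′ ω` AND `resGMidBlock ξ μω` NON-ZERO**: in the currency of K2E1-p11's generator set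
`resGMidAtomGen` (a continuous pair-section `φ` of the `φ_ξ`-block at level `(K′, ω)`, its inline-continued family `Ec` holomorphic on `{1 < Re} ∖ Sp`, `= E(φ, ·)` on `2 < Re`, a pole
letter `Fp` at `z₀ = 3/2`) plus the three LAYER-2 letters of the same family on that domain (continuity (E4), local bounds (E2-bd), `G(F)`-invariance), an `L²` class `f =ᵐ x ↦ Fp((out x)⁻¹)(3/2)`
and ONE nonzero residue value `Fp g₀ (3/2) ≠ 0` (a genuine pole — the analytic half ★ `residue_at_threeHalves_ne_zero_iff_cm_three` supplies it from `L(½, ξ·bcη⁻¹·μω) ≠ 0`):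
`f ∈ resGMidAtomGen`, `f ≠ 0`, `resGMidAtom ≠ ⊥`, `resGMidBlock ≠ ⊥`.  The square-integrability letter `hr2` of §2 is ABSORBED: the class `f` itself witnesses `quotFun (Fp · (3/2)) ∈ L²`
(Mathlib `MemLp.ae_eq`). [cite: MoeglinWaldspurger1995, I.4.11, IV.1.11] [cite: Rogawski1990, §13.9 (ii) p. 229] -/
theorem resGMidBlock_ne_bot_of_poleLetter (ξ : OneDimAutRepH L) (μω : HeckeCharacter L)
    (K' : Subgroup (quasiSplit (↥(maximalRealSubfield L)) L (IsCMField.complexConj L) 3).Adelic) (ω : ↥K' →* ℂ)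
    (φ : (quasiSplit (↥(maximalRealSubfield L)) L (IsCMField.complexConj L) 3).Adelic → ℂ) (hφ : φ ∈ chiSectionSpacePair (ξ.bcη⁻¹ * ξ.bcψ⁻¹ * μω) ξ.ψ K' (ω : ↥K' → ℂ)) (hφc : Continuous φ)
    (Ec : ℂ → (quasiSplit (↥(maximalRealSubfield L)) L (IsCMField.complexConj L) 3).Adelic → ℂ) (Sp : Finset ℂ) (hSp : ∀ s ∈ Sp, s.im = 0 ∧ 1 < s.re ∧ s.re ≤ 2)
    (hEd : ∀ g, DifferentiableOn ℂ (fun z => Ec z g) ({z : ℂ | 1 < z.re} \ (↑Sp : Set ℂ)))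
    (hE2 : ∀ z : ℂ, 2 < z.re → Ec z = eisensteinSeriesU (flatSectionU φ z))
    (Fp : (quasiSplit (↥(maximalRealSubfield L)) L (IsCMField.complexConj L) 3).Adelic → ℂ → ℂ) (hF : ∀ g, AnalyticAt ℂ (Fp g) ((3 : ℂ) / 2))
    (hFE : ∀ g, Fp g =ᶠ[𝓝[≠] ((3 : ℂ) / 2)] fun z => (z - (3 : ℂ) / 2) * Ec z g)
    -- the three LAYER-2 letters of the same family on the generator's domain
    (hE4 : ∀ z ∈ ({z : ℂ | 1 < z.re} \ (↑Sp : Set ℂ)), Continuous (Ec z))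
    (hEbd : ∀ z₁ ∈ ({z : ℂ | 1 < z.re} \ (↑Sp : Set ℂ)), ∀ K : Set (quasiSplit (↥(maximalRealSubfield L)) L (IsCMField.complexConj L) 3).Adelic, IsCompact K → ∃ V ∈ 𝓝 z₁, ∃ M : ℝ, ∀ z ∈ V, ∀ g ∈ K, ‖Ec z g‖ ≤ M)
    (hEcinv : ∀ z ∈ ({z : ℂ | 1 < z.re} \ (↑Sp : Set ℂ)), ∀ (γ : (quasiSplit (↥(maximalRealSubfield L)) L (IsCMField.complexConj L) 3).arithmeticSubgroup) (x : (quasiSplit (↥(maximalRealSubfield L)) L (IsCMField.complexConj L) 3).Adelic), Ec z ((γ : (quasiSplit (↥(maximalRealSubfield L)) L (IsCMField.complexConj L) 3).Adelic) * x) = Ec z x)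
    -- a genuine pole and the residue class
    {g₀ : (quasiSplit (↥(maximalRealSubfield L)) L (IsCMField.complexConj L) 3).Adelic} (hr0 : Fp g₀ ((3 : ℂ) / 2) ≠ 0) (f : (quasiSplit (↥(maximalRealSubfield L)) L (IsCMField.complexConj L) 3).L2 μ)
    (hf : (f : (quasiSplit (↥(maximalRealSubfield L)) L (IsCMField.complexConj L) 3).automorphicQuotient → ℂ) =ᵐ[μ] fun x => Fp (Quotient.out (x : (quasiSplit (↥(maximalRealSubfield L)) L (IsCMField.complexConj L) 3).Adelic ⧸ (quasiSplit (↥(maximalRealSubfield L)) L (IsCMField.complexConj L) 3).quotientSubgroup))⁻¹ ((3 : ℂ) / 2)) :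
    f ∈ resGMidAtomGen L μ ξ μω K' ω ∧ f ≠ 0 ∧ resGMidAtom L μ ξ μω K' ω ≠ ⊥ ∧ (resGMidBlock L μ ξ μω).toSubmodule ≠ ⊥ := by
  have hmem : f ∈ resGMidAtomGen L μ ξ μω K' ω := ⟨φ, hφ, hφc, Ec, Sp, hSp, hEd, hE2, Fp, hF, hFE, hf⟩
  obtain ⟨ρ, hρ, hρD⟩ := exists_puncturedBall_subset_of_finset Sp
  have hDo : IsOpen ({z : ℂ | 1 < z.re} \ (↑Sp : Set ℂ)) := (isOpen_lt continuous_const Complex.continuous_re).sdiff Sp.finite_toSet.isClosed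
  have hD : ∀ᶠ z in 𝓝[≠] ((3 : ℂ) / 2), z ∈ ({z : ℂ | 1 < z.re} \ (↑Sp : Set ℂ)) := by
    filter_upwards [inter_mem_nhdsWithin _ (ball_mem_nhds ((3 : ℂ) / 2) hρ)] with z hz
    exact hρD z hz.1 (mem_ball.1 hz.2)
  -- the residue function is square-integrable: `f` itself is its `L²` class
  have hr2 : MemLp ((quasiSplit (↥(maximalRealSubfield L)) L (IsCMField.complexConj L) 3).quotFun fun g => Fp g ((3 : ℂ) / 2)) 2 μ := (Lp.memLp f).ae_eq hf
  have hr : ∀ g, Tendsto (fun z : ℂ => (z - (3 : ℂ) / 2) * Ec z g) (𝓝[≠] ((3 : ℂ) / 2)) (𝓝 (Fp g ((3 : ℂ) / 2))) := fun g =>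
    (tendsto_nhdsWithin_of_tendsto_nhds (hF g).continuousAt.tendsto).congr' (hFE g)
  have hrc : Continuous fun g => Fp g ((3 : ℂ) / 2) := continuous_residueValue_at Ec hDo hρ hρD hEd hE4 hEbd Fp hF hFE
  have hne0 : hr2.toLp ((quasiSplit (↥(maximalRealSubfield L)) L (IsCMField.complexConj L) 3).quotFun fun g => Fp g ((3 : ℂ) / 2)) ≠ 0 := toLp_residueFun_ne_zero μ Ec hD hEcinv hr hrc hr2 hr0
  have heq : hr2.toLp ((quasiSplit (↥(maximalRealSubfield L)) L (IsCMField.complexConj L) 3).quotFun fun g => Fp g ((3 : ℂ) / 2)) = f := Lp.ext (hr2.coeFn_toLp.trans hf.symm)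
  have hf0 : f ≠ 0 := heq ▸ hne0
  have hmemA : f ∈ resGMidAtom L μ ξ μω K' ω := mem_resGMidAtom_of_mem_gen L μ ξ μω K' ω hmem
  exact ⟨hmem, hf0, ne_bot_of_mem_of_ne_zero μ hmemA hf0, resGMidBlock_ne_bot_of_mem L μ ξ μω K' ω hmemA hf0⟩

end ByName

end Summit.HodgeConjecture.HodgeConjecture.R90.S8

end
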